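import Summits.CriticalPhenomena.CardyFormulaZ2.Theorems.CardyComplexConeEdgePrecompactUFRSDoublyMarkedLoop

/-!
# Arm domination, INITIAL case: the certificate when the translate's exploration exits without meeting the ball
(line `qkz-strip-boundary-arm` of crux `CardyComplexCone.EdgePrecompact`, stmt-CriticalPhenomena-11387;
analysis of the registered residual `ufrs_initialContactCase_cert(J)` of the corrected arm domination
`ufrs_armDomination2`, see `…UFRSArmDominationInitial.lean`, `…UFRSArmDominationResiduals.lean`,
`…UFRSInitialContactFarBigon.lean`)

Setting: an admissible datum `E` of the Jordan Dobrushin domain `D`, its translate `shiftData E w`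
(`‖E.δ w‖ < η`), the START pair `a`, `a'` (start corners of `E` and of the translate), the good first
stretch `S₀ = O₀ a [0, n]` of `β₀ = E.bcBondConfig ω` entering the `2ρ`-deep ball `B(E.δ v, ρ)` at
time `n` through inner faces, and the run `O₁ a' [0, T]` of `β₁ = (shiftData E w).bcBondConfig ω`
avoiding the ball and leaving the inner faces of the translate at time `T + 1` (so `O₁ a' [0, T]`
is the whole exploration path of the translate and `O₁ a' T` its exit corner).

`ufrs_initialExit_loopCert_IC`: in this EXIT configuration the certificate
`ω ∈ ufrsCert E w z (4η) (ρ/2)` holds at a collar point `z ∈ D` — WITHOUT any hypothesis on the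
contacts of the two start strands or on their turning offset. This is the loop argument of the
doubly marked residual (`translateLoop_DM`, `ufrs_doublyMarkedCase_cert`, worker W-DM) transported
to the INITIAL data: the deep re-entry corner `x₀ = O₀ a n` is off the translate's exploration
(whose targets avoid the ball), so its `β₁`-orbit `Λ` is a simple loop through inner faces of
the translate; read backwards from `x₀` it agrees with `S₀` down to the first backward
disagreement — a collar discrepancy corner `p♭ = O₀ a jb`, next to which the rest of the period
of `Λ` ends: a LONG `β₁`-strand from the ball, corner-disjoint from `O₀ a [jb + 1, n]` — or, if
there is no disagreement, all the way down to the start corner `a`, next to which the rest of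
the period ends. In both cases a collar point carries two long strands and the prefix of `S₀`
back to the marked edge `e_a = cSrc a` (`mem_ufrsCert_of_two_far_and_marked_W3H`,
`mem_ufrsCert_of_three_far_W3H`), possibly after moving to the first contact of the strand with
that prefix (again a collar discrepancy corner).

Role: this discharges the EXIT sub-case of the residual `ufrs_initialContactCase_certJ` (and of
its sibling `ufrs_initialExitNearCase_cert`) with the certificate in its ORIGINAL (non-junction)
form; the planar "small start-bigon exclusion" originally planned for this residual is FALSE in
general (a thin fjord of `Dᶜ` at the marked point bridged by the shift; see the worker's evidence
file), and is not used.

References: S. Smirnov, C. R. Acad. Sci. Paris 333 (2001), §2 (exploration path, its exit at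
`e_b`); G. Grimmett, *Percolation* (1999), §11.2; P. Nolin, Electron. J. Probab. 13 (2008), §4.
-/

set_option linter.unusedVariables false

namespace Summit.CriticalPhenomena.CardyFormulaZ2.Cruxes.EdgePrecompact.QkzStripBoundaryArm

open MeasureTheory Filter Set Metric
open scoped Topology BigOperators Pointwise
open Literature.Probability.LatticeModels Literature.Probability.Percolation
open Literature.Probability.RandomPlanarGeometry (DobrushinDomain)
open Summit.CriticalPhenomena.CardyFormulaZ2.Theses.CardyComplexCone

noncomputable section

/-- **INITIAL case, EXIT configuration: the translate's interface loop through the deep re-entry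
corner certifies** (helper `ufrs_initialExit_loopCert_IC` of stmt-CriticalPhenomena-11387). DATA:
start corners `a` of `E` and `a'` of `shiftData E w`, the good first stretch `O₀ a [0, n]` entering
the `2ρ`-deep ball of radius `ρ ≥ 4η` at `n`, the run `O₁ a' [0, T]` of the translate's completion
avoiding the ball (targets of `O₁ a' 0, …, O₁ a' T` off the ball) and leaving the inner faces of the
translate at `T + 1`. CONCLUSION: `ω ∈ ufrsCert E w z (4η) (ρ/2)` at a collar point `z ∈ D`.
PROOF: outside the escape regime, the `β₁`-orbit `Λ` of `x₀ = O₀ a n` is a simple loop through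
inner faces of the translate (`translateLoop_DM`); read backwards from `x₀` it agrees with `O₀ a`
down to the first backward disagreement, whose `β₀`-corner `O₀ a jb` is a collar discrepancy corner
next to which the remaining `β₁`-strand of the period (from next to the ball) ends, corner-disjoint
from `O₀ a [jb + 1, n]`; with the prefix `O₀ a [0, jb)` back to the marked edge `cSrc a` this gives
the certificate at `E.δ (O₀ a jb).1` or at the strand's first contact with the prefix; without any
disagreement the strand ends next to `a` itself and the certificate holds at `E.δ a.1`. -/
theorem ufrs_initialExit_loopCert_IC : ∀ (D : DobrushinDomain) (η : ℝ), 0 < η → ∃ δ₀ > (0:ℝ), ∀ E : DiscreteDobrushin, E.Ω = D.carrier → E.IsZdAdmissible → E.δ < δ₀ → ∀ (v w : Site 2) (ρ : ℝ), 4 * η ≤ ρ → 2 * ρ ≤ infDist (meshPoint E.δ v) D.carrierᶜ → ‖meshPoint E.δ w‖ < η → ∀ (ω : BondConfig (Site 2)) (a a' : Site 2 × Fin 4) (n T : ℕ), E.IsStartCorner a → (shiftData E w).IsStartCorner a' → (∀ i < n, medialPoint E.δ (cTgt (cornerOrbit (E.bcBondConfig ω) a i)) ∉ ball (meshPoint E.δ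 v) ρ ∧ E.IsInnerFace (cFace (cornerOrbit (E.bcBondConfig ω) a (i + 1)))) → medialPoint E.δ (cTgt (cornerOrbit (E.bcBondConfig ω) a n)) ∈ ball (meshPoint E.δ v) ρ → (∀ i < T, medialPoint E.δ (cTgt (cornerOrbit ((shiftData E w).bcBondConfig ω) a' i)) ∉ ball (meshPoint E.δ v) ρ ∧ (shiftData E w).IsInnerFace (cFace (cornerOrbit ((shiftData E w).bcBondConfig ω) a' (i + 1)))) → medialPoint E.δ (cTgt (cornerOrbit ((shiftData E w).bcBondConfig ω) a' T)) ∉ ball (meshPoint E.δ v) ρ → ¬ (shiftData E w).IsInnerFace (cFace (cornerOrbit ((shiftData E w).bcBondConfig ω) a' (T + 1))) → ∃ z ∈ D.carrier, infDist z D.carrierᶜ < 3 * η ∧ ω ∈ ufrsCert E w z (4 * η) (ρ / 2) := by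
  classical
  intro D η hη
  obtain ⟨δ₂, hδ₂, hcollar⟩ := collarAgreement D η hη
  refine ⟨min δ₂ η, lt_min hδ₂ hη, ?_⟩
  intro E hEΩ hE hEδ v w ρ hηρ hv hw ω a a' n T ha ha' hStr hball hrun hTball hout
  have hδ : 0 < E.δ := hE.delta_pos
  have hδ₂' : E.δ < δ₂ := lt_of_lt_of_le hEδ (min_le_left _ _)
  have hδη : E.δ ≤ η := (lt_of_lt_of_le hEδ (min_le_right _ _)).le
  have hE₁ : (shiftData E w).IsZdAdmissible := isZdAdmissible_shiftData E w hE
  -- the two dynamics agree off the collar; faces at deep vertices are inner for both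
  have hagree : ∀ p : Site 2 × Fin 4, 3 * η ≤ infDist (meshPoint E.δ p.1) D.carrierᶜ → (cTgt p ∈ (E.bcBondConfig ω) ↔ cTgt p ∈ ((shiftData E w).bcBondConfig ω)) := by
    rintro ⟨y, kk⟩ hp
    have h := (hcollar E hEΩ hE hδ₂' w hw ω y hp y (by rw [dist_self]; positivity)).1 kk
    exact h.1.trans h.2.symm
  have hcol_of_disc : ∀ p : Site 2 × Fin 4, ¬ (cTgt p ∈ (E.bcBondConfig ω) ↔ cTgt p ∈ ((shiftData E w).bcBondConfig ω)) → infDist (meshPoint E.δ p.1) D.carrierᶜ < 3 * η :=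
    fun p hp => lt_of_not_ge fun h => hp (hagree p h)
  have hinner : ∀ x : Site 2, 3 * η ≤ infDist (meshPoint E.δ x) D.carrierᶜ → ∀ f : Site 2, IsCorner x f → E.IsInnerFace f ∧ (shiftData E w).IsInnerFace f :=
    fun x hx => (hcollar E hEΩ hE hδ₂' w hw ω x hx x (by rw [dist_self]; positivity)).2
  have hfaceE : ∀ t ≤ n, E.IsInnerFace (cFace (cornerOrbit (E.bcBondConfig ω) a t)) := by
    intro t ht
    rcases Nat.eq_zero_or_pos t with rfl | hpos
    · exact ha.isOutEdge.1
    · obtain ⟨t', rfl⟩ : ∃ t', t = t' + 1 := ⟨t - 1, by omega⟩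
      exact (hStr t' (by omega)).2
  have hsimple : ∀ s t, s < t → t ≤ n → cornerOrbit (E.bcBondConfig ω) a s ≠ cornerOrbit (E.bcBondConfig ω) a t :=
    fun s t hst htn => cornerOrbit_ne hE ha hst (fun k hk => hfaceE k (by omega))
  have hzD : ∀ t ≤ n, meshPoint E.δ (cornerOrbit (E.bcBondConfig ω) a t).1 ∈ D.carrier := by
    intro t ht
    rw [← hEΩ]
    exact (ufrs_discrepancyEdges E w ω).2.2 _ (hfaceE t ht)
  have hcola : infDist (meshPoint E.δ a.1) D.carrierᶜ < 3 * η := by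
    by_contra h
    rw [not_lt] at h
    exact ha.isOutEdge.2 (hinner a.1 h (faceAt a.1 (a.2 + 3)) (isCorner_faceAt _ _)).1
  -- escape regime
  by_cases hesc : ρ / 2 < 256 * (4 * η)
  · exact ⟨_, hzD 0 (Nat.zero_le _), hcola, mem_ufrsCert_of_lt_W3H hesc⟩
  rw [not_lt] at hesc
  -- the deep re-entry corner `x₀ = O₀ a n` is off the translate's exploration `O₁ a' [0, T]`
  have hx₀deep : 3 * η ≤ infDist (meshPoint E.δ (cornerOrbit (E.bcBondConfig ω) a n).1) D.carrierᶜ := deep_of_cTgt_mem_ball_W3H hδ.le hδη hηρ hv hball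
  have hdeep₁ : ∀ f, IsCorner (cornerOrbit (E.bcBondConfig ω) a n).1 f → (shiftData E w).IsInnerFace f := fun f hf => (hinner _ hx₀deep f hf).2
  have hx₀notin : ∀ s ≤ T, (cornerOrbit (E.bcBondConfig ω) a n) ≠ cornerOrbit ((shiftData E w).bcBondConfig ω) a' s := by
    intro s hs heq
    rcases Nat.lt_or_ge s T with hsT | hsT
    · exact (hrun s hsT).1 (by rw [← heq]; exact hball)
    · have hsT' : s = T := by omega
      rw [hsT'] at heq
      exact hTball (by rw [← heq]; exact hball)
  have hKin : (shiftData E w).IsInnerFace (cFace (cornerOrbit ((shiftData E w).bcBondConfig ω) a' T)) := by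
    rcases Nat.eq_zero_or_pos T with hT0 | hTpos
    · rw [hT0]
      exact ha'.isOutEdge.1
    · obtain ⟨T', rfl⟩ : ∃ T', T = T' + 1 := ⟨T - 1, by omega⟩
      exact (hrun T' (by omega)).2
  obtain ⟨hΛin, L, hL0, hΛL, hΛsimple⟩ := translateLoop_DM E hE ω w a' (cornerOrbit (E.bcBondConfig ω) a n) T ha' hKin hout hdeep₁ hx₀notin
  -- far ends: next to the ball
  have hfar : ∀ (c y : Site 2), infDist (meshPoint E.δ c) D.carrierᶜ < 3 * η → dist (meshPoint E.δ y) (meshPoint E.δ (cornerOrbit (E.bcBondConfig ω) a n).1) ≤ E.δ →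
      ρ / 2 / 2 ≤ dist (meshPoint E.δ y) (meshPoint E.δ c) := by
    intro c y hc hy
    have := far_of_near_cTgt_mem_ball_W3H hδ.le hv hc (z := meshPoint E.δ c) (s := 0) (by rw [dist_self]) hball hy
    linarith
  have hΛ1near : dist (meshPoint E.δ (cornerOrbit ((shiftData E w).bcBondConfig ω) (cornerOrbit (E.bcBondConfig ω) a n) 1).1) (meshPoint E.δ (cornerOrbit (E.bcBondConfig ω) a n).1) ≤ E.δ := by
    have h := dist_meshPoint_cornerOrbit_succ_le ((shiftData E w).bcBondConfig ω) (cornerOrbit (E.bcBondConfig ω) a n) E.δ 0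
    rwa [abs_of_pos hδ] at h
  have hx₀self : dist (meshPoint E.δ (cornerOrbit (E.bcBondConfig ω) a n).1) (meshPoint E.δ (cornerOrbit (E.bcBondConfig ω) a n).1) ≤ E.δ := by
    rw [dist_self]; exact hδ.le
  -- the first stretch has at least one step (its end is deep, its start is a collar corner)
  have hn1 : 1 ≤ n := by
    rcases Nat.eq_zero_or_pos n with hn0 | hpos
    · exfalso
      have h2 := hfar a.1 _ hcola hx₀self
      rw [hn0] at h2
      have h3 : dist (meshPoint E.δ (cornerOrbit (E.bcBondConfig ω) a 0).1) (meshPoint E.δ a.1) = 0 := dist_self _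
      linarith
    · exact hpos
  -- assembling the certificate at a collar corner `O₀ a r` of the first stretch next to which a
  -- `β₁`-strand `Λ [1, ℓ]` from the ball ends, corner-disjoint from the whole first stretch
  have key : ∀ (r ℓ : ℕ), r < n → 1 ≤ ℓ → ℓ < L →
      infDist (meshPoint E.δ (cornerOrbit (E.bcBondConfig ω) a r).1) D.carrierᶜ < 3 * η →
      dist (meshPoint E.δ (cornerOrbit ((shiftData E w).bcBondConfig ω) (cornerOrbit (E.bcBondConfig ω) a n) ℓ).1) (meshPoint E.δ (cornerOrbit (E.bcBondConfig ω) a r).1) ≤ E.δ →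
      (∀ t, 1 ≤ t → t ≤ ℓ → ∀ u ≤ n, cornerOrbit ((shiftData E w).bcBondConfig ω) (cornerOrbit (E.bcBondConfig ω) a n) t ≠ cornerOrbit (E.bcBondConfig ω) a u) →
      ∃ z ∈ D.carrier, infDist z D.carrierᶜ < 3 * η ∧ ω ∈ ufrsCert E w z (4 * η) (ρ / 2) := by
    intro r ℓ hrn hℓ1 hℓL hcolr hnear hdisj
    refine ⟨meshPoint E.δ (cornerOrbit (E.bcBondConfig ω) a r).1, hzD r hrn.le, hcolr, ?_⟩
    have hδ4 : E.δ ≤ 4 * η := by linarith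
    have hS1near : dist (meshPoint E.δ (cornerOrbit (E.bcBondConfig ω) a (r + 1)).1) (meshPoint E.δ (cornerOrbit (E.bcBondConfig ω) a r).1) ≤ 4 * η := by
      have h := dist_meshPoint_cornerOrbit_succ_le (E.bcBondConfig ω) a E.δ r
      rw [abs_of_pos hδ] at h
      linarith
    have hS1 : ∀ R' : ℝ, R' ≤ ρ / 2 / 2 → (r + 1) ≤ n ∧ ((dist (meshPoint E.δ (cornerOrbit (E.bcBondConfig ω) a (r + 1)).1) (meshPoint E.δ (cornerOrbit (E.bcBondConfig ω) a r).1) ≤ (4 * η) ∧ R' ≤ dist (meshPoint E.δ (cornerOrbit (E.bcBondConfig ω) a n).1) (meshPoint E.δ (cornerOrbit (E.bcBondConfig ω) a r).1)) ∨ (R' ≤ dist (meshPoint E.δ (cornerOrbit (E.bcBondConfig ω) a (r + 1)).1) (meshPoint E.δ (cornerOrbit (E.bcBondConfig ω) a r).1) ∧ dist (meshPoint E.δ (cornerOrbit (E.bcBondConfig ω) a n).1) (meshPoint E.δ (cornerOrbit (E.bcBondConfig ω) a r).1) ≤ (4 * η))) ∧ (∀ t, (r + 1) ≤ t → t ≤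 n → E.IsInnerFace (cFace (cornerOrbit (E.bcBondConfig ω) a t))) ∧ (∀ s t, (r + 1) ≤ s → s < t → t ≤ n → cornerOrbit (E.bcBondConfig ω) a s ≠ cornerOrbit (E.bcBondConfig ω) a t) :=
      fun R' hR' => ⟨hrn, Or.inl ⟨hS1near, hR'.trans (hfar _ _ hcolr hx₀self)⟩, fun t _ ht => hfaceE t ht, fun s t _ hst htn => hsimple s t hst htn⟩
    have hS2 : ∀ R' : ℝ, R' ≤ ρ / 2 / 2 → 1 ≤ ℓ ∧ ((dist (meshPoint E.δ (cornerOrbit ((shiftData E w).bcBondConfig ω) (cornerOrbit (E.bcBondConfig ω) a n) 1).1) (meshPoint E.δ (cornerOrbit (E.bcBondConfig ω) a r).1) ≤ (4 * η) ∧ R' ≤ dist (meshPoint E.δ (cornerOrbit ((shiftData E w).bcBondConfig ω) (cornerOrbit (E.bcBondConfig ω) a n) ℓ).1) (meshPoint E.δ (cornerOrbit (E.bcBondConfig ω) a r).1)) ∨ (R' ≤ dist (meshPoint E.δ (cornerOrbit ((shiftData E w).bcBondConfig ω) (cornerOrbit (E.bcBondConfig ω) a n) 1).1) (meshPoint E.δ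 (cornerOrbit (E.bcBondConfig ω) a r).1) ∧ dist (meshPoint E.δ (cornerOrbit ((shiftData E w).bcBondConfig ω) (cornerOrbit (E.bcBondConfig ω) a n) ℓ).1) (meshPoint E.δ (cornerOrbit (E.bcBondConfig ω) a r).1) ≤ (4 * η))) ∧ (∀ t, 1 ≤ t → t ≤ ℓ → (shiftData E w).IsInnerFace (cFace (cornerOrbit ((shiftData E w).bcBondConfig ω) (cornerOrbit (E.bcBondConfig ω) a n) t))) ∧ (∀ s t, 1 ≤ s → s < t → t ≤ ℓ → cornerOrbit ((shiftData E w).bcBondConfig ω) (cornerOrbit (E.bcBondConfig ω) a n) s ≠ cornerOrbit ((shiftData E w).bcBondConfig ω) (cornerOrbit (E.bcBondConfig ω) a n) t) :=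
      fun R' hR' => ⟨hℓ1, Or.inr ⟨hR'.trans (hfar _ _ hcolr hΛ1near), hnear.trans hδ4⟩, fun t _ _ => hΛin t, fun s t _ hst htl => hΛsimple s t hst (by omega)⟩
    have hS12 : ∀ s t, (r + 1) ≤ s → s ≤ n → 1 ≤ t → t ≤ ℓ → cornerOrbit (E.bcBondConfig ω) a s ≠ cornerOrbit ((shiftData E w).bcBondConfig ω) (cornerOrbit (E.bcBondConfig ω) a n) t :=
      fun s t _ hsn ht1 htl h => hdisj t ht1 htl s hsn h.symm
    have hmk : ∀ X : ℝ, dist (meshPoint E.δ a.1) (meshPoint E.δ (cornerOrbit (E.bcBondConfig ω) a r).1) ≤ X → ∃ e₀ : Sym2 (Site 2), (e₀ ∈ E.zdABEdges ∨ e₀ ∈ (shiftData E w).zdABEdges) ∧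
        dist (medialPoint E.δ e₀) (meshPoint E.δ (cornerOrbit (E.bcBondConfig ω) a r).1) ≤ X + E.δ := by
      intro X hX
      refine ⟨cSrc a, Or.inl (DiscreteDobrushin.cSrc_mem_zdABEdges ha.mem_zdArcA ha.mem_zdArcB (Or.inl ha.isOutEdge)), ?_⟩
      have h1 := dist_medialPoint_cSrc_le' hδ.le a
      have h2 := dist_triangle (medialPoint E.δ (cSrc a)) (meshPoint E.δ a.1) (meshPoint E.δ (cornerOrbit (E.bcBondConfig ω) a r).1)
      linarith
    rcases Nat.eq_zero_or_pos r with hr0 | hrpos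
    · -- the collar corner is the start corner: the marked edge `cSrc a` is at `z`
      subst hr0
      have hX0 : dist (meshPoint E.δ a.1) (meshPoint E.δ (cornerOrbit (E.bcBondConfig ω) a 0).1) ≤ 0 := by
        show dist (meshPoint E.δ a.1) (meshPoint E.δ a.1) ≤ 0
        rw [dist_self]
      have hXlt : (0:ℝ) < ρ / 2 / 2 := by linarith
      exact mem_ufrsCert_of_two_far_and_marked_W3H true false true a (cornerOrbit (E.bcBondConfig ω) a n) a (0 + 1) n 1 ℓ 0 0 hη hδη hXlt (hmk 0 hX0) hS1 hS2 hS12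
        (fun hbig => False.elim (by linarith))
    · -- the prefix `O₀ a [0, r - 1]`, read back to the start corner
      have hS3near : dist (meshPoint E.δ (cornerOrbit (E.bcBondConfig ω) a (r - 1)).1) (meshPoint E.δ (cornerOrbit (E.bcBondConfig ω) a r).1) ≤ 4 * η := by
        have h := dist_meshPoint_cornerOrbit_succ_le (E.bcBondConfig ω) a E.δ (r - 1)
        rw [abs_of_pos hδ, Nat.sub_add_cancel hrpos, dist_comm] at h
        linarith
      have hS3 : ∀ R' : ℝ, R' ≤ dist (meshPoint E.δ a.1) (meshPoint E.δ (cornerOrbit (E.bcBondConfig ω) a r).1) → 0 ≤ (r - 1) ∧ ((dist (meshPoint E.δ (cornerOrbit (E.bcBondConfig ω) a 0).1) (meshPoint E.δ (cornerOrbit (E.bcBondConfig ω) a r).1) ≤ (4 * η) ∧ R' ≤ dist (meshPoint E.δ (cornerOrbit (E.bcBondConfig ω) a (r - 1)).1) (meshPoint E.δ (cornerOrbit (E.bcBondConfig ω) a r).1)) ∨ (R' ≤ dist (meshPoint E.δ (cornerOrbit (E.bcBondConfig ω) a 0).1) (meshPoint E.δ (cornerOrbit (E.bcBondConfig ω) a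 r).1) ∧ dist (meshPoint E.δ (cornerOrbit (E.bcBondConfig ω) a (r - 1)).1) (meshPoint E.δ (cornerOrbit (E.bcBondConfig ω) a r).1) ≤ (4 * η))) ∧ (∀ t, 0 ≤ t → t ≤ (r - 1) → E.IsInnerFace (cFace (cornerOrbit (E.bcBondConfig ω) a t))) ∧ (∀ s t, 0 ≤ s → s < t → t ≤ (r - 1) → cornerOrbit (E.bcBondConfig ω) a s ≠ cornerOrbit (E.bcBondConfig ω) a t) :=
        fun R' hR' => ⟨Nat.zero_le _, Or.inr ⟨hR', hS3near⟩, fun t _ ht => hfaceE t (by omega), fun s t _ hst ht => hsimple s t hst (by omega)⟩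
      have hS13 : ∀ s t, (r + 1) ≤ s → s ≤ n → 0 ≤ t → t ≤ (r - 1) → cornerOrbit (E.bcBondConfig ω) a s ≠ cornerOrbit (E.bcBondConfig ω) a t :=
        fun s t hs hsn _ ht h => hsimple t s (by omega) hsn h.symm
      have hS23 : ∀ s t, 1 ≤ s → s ≤ ℓ → 0 ≤ t → t ≤ (r - 1) → cornerOrbit ((shiftData E w).bcBondConfig ω) (cornerOrbit (E.bcBondConfig ω) a n) s ≠ cornerOrbit (E.bcBondConfig ω) a t :=
        fun s t hs hsl _ ht => hdisj s hs hsl t (by omega)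
      by_cases hXfar : ρ / 2 / 2 ≤ dist (meshPoint E.δ a.1) (meshPoint E.δ (cornerOrbit (E.bcBondConfig ω) a r).1)
      · exact mem_ufrsCert_of_three_far_W3H true false true a (cornerOrbit (E.bcBondConfig ω) a n) a (r + 1) n 1 ℓ 0 (r - 1) hη hesc (hS1 _ le_rfl) (hS2 _ le_rfl)
          (hS3 _ hXfar) hS12 hS13 hS23
      · rw [not_le] at hXfar
        exact mem_ufrsCert_of_two_far_and_marked_W3H true false true a (cornerOrbit (E.bcBondConfig ω) a n) a (r + 1) n 1 ℓ 0 (r - 1) hη hδη hXfar (hmk _ le_rfl)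
          hS1 hS2 hS12 (fun _ => ⟨hS3 _ le_rfl, hS13, hS23⟩)
  -- backward agreement of the loop with the first stretch
  have hCgen : ∀ A : ℕ, (∀ τ < A, nextCorner ((shiftData E w).bcBondConfig ω) (cornerOrbit (E.bcBondConfig ω) a (n - 1 - τ)) = cornerOrbit (E.bcBondConfig ω) a (n - τ)) → ∀ τ, τ ≤ A → τ ≤ L → cornerOrbit ((shiftData E w).bcBondConfig ω) (cornerOrbit (E.bcBondConfig ω) a n) (L - τ) = cornerOrbit (E.bcBondConfig ω) a (n - τ) := by
    intro A hAmin τ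
    induction τ with
    | zero =>
      intro _ _
      rw [Nat.sub_zero, Nat.sub_zero]
      exact hΛL
    | succ τ ih =>
      intro hτA hτL
      have h1 := ih (by omega) (by omega)
      have h2 : nextCorner ((shiftData E w).bcBondConfig ω) (cornerOrbit ((shiftData E w).bcBondConfig ω) (cornerOrbit (E.bcBondConfig ω) a n) (L - (τ + 1))) = cornerOrbit (E.bcBondConfig ω) a (n - τ) := by
        rw [← h1]
        show cornerOrbit ((shiftData E w).bcBondConfig ω) (cornerOrbit (E.bcBondConfig ω) a n) (L - (τ + 1) + 1) = cornerOrbit ((shiftData E w).bcBondConfig ω) (cornerOrbit (E.bcBondConfig ω) a n) (L - τ)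
        rw [show L - (τ + 1) + 1 = L - τ by omega]
      have h3 : nextCorner ((shiftData E w).bcBondConfig ω) (cornerOrbit (E.bcBondConfig ω) a (n - (τ + 1))) = cornerOrbit (E.bcBondConfig ω) a (n - τ) := by
        rw [show n - (τ + 1) = n - 1 - τ by omega]
        exact hAmin τ (by omega)
      exact nextCorner_injective (h2.trans h3.symm)
  by_cases hex : ∃ τ, τ ≤ n - 1 ∧ nextCorner ((shiftData E w).bcBondConfig ω) (cornerOrbit (E.bcBondConfig ω) a (n - 1 - τ)) ≠ cornerOrbit (E.bcBondConfig ω) a (n - τ)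
  · -- a backward disagreement: down to the index `n - A = s⋆`
    obtain ⟨A, hAle, hAnot, hAmin⟩ : ∃ A, A ≤ n - 1 ∧ nextCorner ((shiftData E w).bcBondConfig ω) (cornerOrbit (E.bcBondConfig ω) a (n - 1 - A)) ≠ cornerOrbit (E.bcBondConfig ω) a (n - A) ∧
        ∀ τ < A, nextCorner ((shiftData E w).bcBondConfig ω) (cornerOrbit (E.bcBondConfig ω) a (n - 1 - τ)) = cornerOrbit (E.bcBondConfig ω) a (n - τ) := by
      refine ⟨Nat.find hex, (Nat.find_spec hex).1, (Nat.find_spec hex).2, fun τ hτ => ?_⟩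
      have h := Nat.find_min hex hτ
      push Not at h
      exact h (le_trans hτ.le (Nat.find_spec hex).1)
    have hC := hCgen A hAmin
    have hAL : A < L := by
      by_contra h
      rw [not_lt] at h
      have h1 := hC L h le_rfl
      rw [Nat.sub_self] at h1
      exact hsimple (n - L) n (by omega) le_rfl h1.symm
    -- the departure: `p♭ = O₀ a jb`, `jb = n - 1 - A`; its successor `O₀ a (jb + 1)` has the
    -- `β₁`-predecessor `p♯ = Λ (L - A - 1) ≠ p♭`, so `cTgt p♭` is a discrepancy edge
    obtain ⟨jb, hjb⟩ : ∃ jb, jb = n - 1 - A := ⟨_, rfl⟩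
    have hjb1 : jb + 1 = n - A := by omega
    have hjbn : jb < n := by omega
    rw [← hjb] at hAnot
    have hpsharp : nextCorner ((shiftData E w).bcBondConfig ω) (cornerOrbit ((shiftData E w).bcBondConfig ω) (cornerOrbit (E.bcBondConfig ω) a n) (L - A - 1)) = cornerOrbit (E.bcBondConfig ω) a (jb + 1) := by
      rw [hjb1, ← hC A le_rfl hAL.le]
      show cornerOrbit ((shiftData E w).bcBondConfig ω) (cornerOrbit (E.bcBondConfig ω) a n) (L - A - 1 + 1) = cornerOrbit ((shiftData E w).bcBondConfig ω) (cornerOrbit (E.bcBondConfig ω) a n) (L - A)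
      rw [show L - A - 1 + 1 = L - A by omega]
    have hne : cornerOrbit ((shiftData E w).bcBondConfig ω) (cornerOrbit (E.bcBondConfig ω) a n) (L - A - 1) ≠ cornerOrbit (E.bcBondConfig ω) a jb := by
      intro h
      apply hAnot
      rw [← hjb1, ← h]
      exact hpsharp
    have hdisc : ¬ (cTgt (cornerOrbit (E.bcBondConfig ω) a jb) ∈ (E.bcBondConfig ω) ↔ cTgt (cornerOrbit (E.bcBondConfig ω) a jb) ∈ ((shiftData E w).bcBondConfig ω)) := by
      intro hiff
      apply hne
      apply nextCorner_injective (β := ((shiftData E w).bcBondConfig ω))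
      rw [hpsharp, ← nextCorner_congr_of_iff hiff]
      rfl
    have hcolb : infDist (meshPoint E.δ (cornerOrbit (E.bcBondConfig ω) a jb).1) D.carrierᶜ < 3 * η := hcol_of_disc _ hdisc
    have hsharp_near : dist (meshPoint E.δ (cornerOrbit ((shiftData E w).bcBondConfig ω) (cornerOrbit (E.bcBondConfig ω) a n) (L - A - 1)).1) (meshPoint E.δ (cornerOrbit (E.bcBondConfig ω) a jb).1) ≤ E.δ := by
      apply dist_meshPoint_le_of_mem_cTgt_DM hδ.le
      have h1 : cTgt (cornerOrbit ((shiftData E w).bcBondConfig ω) (cornerOrbit (E.bcBondConfig ω) a n) (L - A - 1)) = cTgt (cornerOrbit (E.bcBondConfig ω) a jb) := by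
        rw [← cSrc_nextCorner (β := ((shiftData E w).bcBondConfig ω)) (cornerOrbit ((shiftData E w).bcBondConfig ω) (cornerOrbit (E.bcBondConfig ω) a n) (L - A - 1)), hpsharp, ← cSrc_nextCorner (β := (E.bcBondConfig ω)) (cornerOrbit (E.bcBondConfig ω) a jb)]
        rfl
      rw [← h1]
      exact Sym2.mem_mk_left _ _
    -- the strand `Λ [1, L - A - 1]` misses `O₀ a [jb + 1, n]` (simplicity of the period)
    have hperiod : ∀ t, 1 ≤ t → t ≤ L - A - 1 → ∀ u, jb + 1 ≤ u → u ≤ n → cornerOrbit ((shiftData E w).bcBondConfig ω) (cornerOrbit (E.bcBondConfig ω) a n) t ≠ cornerOrbit (E.bcBondConfig ω) a u := by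
      intro t ht1 ht u hu1 hun h
      have hC' := hC (n - u) (by omega) (by omega)
      rw [show n - (n - u) = u by omega] at hC'
      rcases Nat.eq_zero_or_pos (n - u) with h0 | hpos
      · rw [h0, Nat.sub_zero, hΛL] at hC'
        exact hΛsimple 0 t (by omega) (by omega) (hC'.trans h.symm)
      · exact hΛsimple t (L - (n - u)) (by omega) (by omega) (h.trans hC'.symm)
    -- case analysis: does the `β₁`-strand `Λ [1, L - A - 1]` meet the prefix `O₀ a [0, jb]`?
    by_cases hcontact : ∃ t, (1 ≤ t ∧ t ≤ L - A - 1) ∧ ∃ u, u ≤ jb ∧ cornerOrbit ((shiftData E w).bcBondConfig ω) (cornerOrbit (E.bcBondConfig ω) a n) t = cornerOrbit (E.bcBondConfig ω) a u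
    · -- first contact `Λ ℓ = O₀ a u`
      obtain ⟨ℓ, ⟨hℓ1, hℓle⟩, ⟨u, hujb, hcu⟩, hmin⟩ : ∃ ℓ, (1 ≤ ℓ ∧ ℓ ≤ L - A - 1) ∧ (∃ u, u ≤ jb ∧ cornerOrbit ((shiftData E w).bcBondConfig ω) (cornerOrbit (E.bcBondConfig ω) a n) ℓ = cornerOrbit (E.bcBondConfig ω) a u) ∧
          ∀ t, 1 ≤ t → t < ℓ → ∀ u' ≤ jb, cornerOrbit ((shiftData E w).bcBondConfig ω) (cornerOrbit (E.bcBondConfig ω) a n) t ≠ cornerOrbit (E.bcBondConfig ω) a u' := by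
        refine ⟨Nat.find hcontact, (Nat.find_spec hcontact).1, (Nat.find_spec hcontact).2, fun t ht1 htℓ u' hu' h => ?_⟩
        exact Nat.find_min hcontact htℓ ⟨⟨ht1, le_trans htℓ.le (Nat.find_spec hcontact).1.2⟩, u', hu', h⟩
      have hdisj : ∀ t, 1 ≤ t → t ≤ ℓ - 1 → ∀ u' ≤ n, cornerOrbit ((shiftData E w).bcBondConfig ω) (cornerOrbit (E.bcBondConfig ω) a n) t ≠ cornerOrbit (E.bcBondConfig ω) a u' := by
        intro t ht1 ht u' hu'n
        rcases le_or_gt u' jb with h | h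
        · exact hmin t ht1 (by omega) u' h
        · exact hperiod t ht1 (by omega) u' (by omega) hu'n
      have hsucc : nextCorner ((shiftData E w).bcBondConfig ω) (cornerOrbit ((shiftData E w).bcBondConfig ω) (cornerOrbit (E.bcBondConfig ω) a n) (ℓ - 1)) = cornerOrbit (E.bcBondConfig ω) a u := by
        rw [← hcu]
        show cornerOrbit ((shiftData E w).bcBondConfig ω) (cornerOrbit (E.bcBondConfig ω) a n) (ℓ - 1 + 1) = cornerOrbit ((shiftData E w).bcBondConfig ω) (cornerOrbit (E.bcBondConfig ω) a n) ℓ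
        rw [Nat.sub_add_cancel hℓ1]
      rcases Nat.eq_zero_or_pos u with hu0 | hupos
      · -- contact at the start corner itself
        rw [hu0] at hsucc
        have hnear : dist (meshPoint E.δ (cornerOrbit ((shiftData E w).bcBondConfig ω) (cornerOrbit (E.bcBondConfig ω) a n) (ℓ - 1)).1) (meshPoint E.δ (cornerOrbit (E.bcBondConfig ω) a 0).1) ≤ E.δ := by
          apply dist_meshPoint_le_of_mem_cSrc_DM hδ.le
          rw [← hsucc, cSrc_nextCorner]
          exact Sym2.mem_mk_left _ _
        have hℓ2 : 2 ≤ ℓ := by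
          by_contra h
          have h1 : ℓ = 1 := by omega
          have h2 := hfar _ _ hcola hx₀self
          rw [h1] at hnear
          have h3 : dist (meshPoint E.δ (cornerOrbit (E.bcBondConfig ω) a n).1) (meshPoint E.δ a.1) ≤ E.δ := hnear
          linarith
        exact key 0 (ℓ - 1) (by omega) (by omega) (by omega) hcola hnear hdisj
      · -- contact at `O₀ a u`, `u ≥ 1`: the collar corner is `O₀ a (u - 1)`
        have hsucc₀ : nextCorner (E.bcBondConfig ω) (cornerOrbit (E.bcBondConfig ω) a (u - 1)) = cornerOrbit (E.bcBondConfig ω) a u := by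
          show cornerOrbit (E.bcBondConfig ω) a (u - 1 + 1) = cornerOrbit (E.bcBondConfig ω) a u
          rw [Nat.sub_add_cancel hupos]
        have hne' : cornerOrbit ((shiftData E w).bcBondConfig ω) (cornerOrbit (E.bcBondConfig ω) a n) (ℓ - 1) ≠ cornerOrbit (E.bcBondConfig ω) a (u - 1) := by
          intro h
          rcases Nat.lt_or_ge 1 ℓ with h2 | h2
          · exact hmin (ℓ - 1) (by omega) (by omega) (u - 1) (by omega) h
          · have h1 : ℓ = 1 := by omega
            rw [h1] at h
            exact hsimple (u - 1) n (by omega) le_rfl h.symm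
        have hdisc' : ¬ (cTgt (cornerOrbit (E.bcBondConfig ω) a (u - 1)) ∈ (E.bcBondConfig ω) ↔ cTgt (cornerOrbit (E.bcBondConfig ω) a (u - 1)) ∈ ((shiftData E w).bcBondConfig ω)) := by
          intro hiff
          apply hne'
          apply nextCorner_injective (β := ((shiftData E w).bcBondConfig ω))
          rw [hsucc, ← nextCorner_congr_of_iff hiff, hsucc₀]
        have hcold : infDist (meshPoint E.δ (cornerOrbit (E.bcBondConfig ω) a (u - 1)).1) D.carrierᶜ < 3 * η := hcol_of_disc _ hdisc'
        have hnear : dist (meshPoint E.δ (cornerOrbit ((shiftData E w).bcBondConfig ω) (cornerOrbit (E.bcBondConfig ω) a n) (ℓ - 1)).1) (meshPoint E.δ (cornerOrbit (E.bcBondConfig ω) a (u - 1)).1) ≤ E.δ := by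
          apply dist_meshPoint_le_of_mem_cTgt_DM hδ.le
          have h1 : cTgt (cornerOrbit ((shiftData E w).bcBondConfig ω) (cornerOrbit (E.bcBondConfig ω) a n) (ℓ - 1)) = cTgt (cornerOrbit (E.bcBondConfig ω) a (u - 1)) := by
            rw [← cSrc_nextCorner (β := ((shiftData E w).bcBondConfig ω)) (cornerOrbit ((shiftData E w).bcBondConfig ω) (cornerOrbit (E.bcBondConfig ω) a n) (ℓ - 1)), hsucc, ← hsucc₀, cSrc_nextCorner]
          rw [← h1]
          exact Sym2.mem_mk_left _ _
        have hℓ2 : 2 ≤ ℓ := by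
          by_contra h
          have h1 : ℓ = 1 := by omega
          have h2 := hfar _ _ hcold hx₀self
          rw [h1] at hnear
          have h3 : dist (meshPoint E.δ (cornerOrbit (E.bcBondConfig ω) a n).1) (meshPoint E.δ (cornerOrbit (E.bcBondConfig ω) a (u - 1)).1) ≤ E.δ := hnear
          linarith
        exact key (u - 1) (ℓ - 1) (by omega) (by omega) (by omega) hcold hnear hdisj
    · -- no contact: the collar corner is `p♭ = O₀ a jb`
      push Not at hcontact
      have hdisj : ∀ t, 1 ≤ t → t ≤ L - A - 1 → ∀ u' ≤ n, cornerOrbit ((shiftData E w).bcBondConfig ω) (cornerOrbit (E.bcBondConfig ω) a n) t ≠ cornerOrbit (E.bcBondConfig ω) a u' := by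
        intro t ht1 ht u' hu'n
        rcases le_or_gt u' jb with h | h
        · exact hcontact t ⟨ht1, ht⟩ u' h
        · exact hperiod t ht1 ht u' (by omega) hu'n
      have hℓ1 : 1 ≤ L - A - 1 := by
        by_contra h
        have h0 : L - A - 1 = 0 := by omega
        rw [h0] at hsharp_near
        have h2 := hfar _ _ hcolb hx₀self
        have h3 : dist (meshPoint E.δ (cornerOrbit (E.bcBondConfig ω) a n).1) (meshPoint E.δ (cornerOrbit (E.bcBondConfig ω) a jb).1) ≤ E.δ := hsharp_near
        linarith
      exact key jb (L - A - 1) hjbn hℓ1 (by omega) hcolb hsharp_near hdisj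

  · -- full backward agreement: the loop passes through the start corner `a`, the rest of its
    -- period is a long `β₁`-strand from the ball back to within one mesh of `a`
    push Not at hex
    have hC := hCgen n (fun τ hτ => hex τ (by omega))
    have hnL : n < L := by
      by_contra h
      rw [not_lt] at h
      have h1 := hC L h le_rfl
      rw [Nat.sub_self] at h1
      exact hsimple (n - L) n (by omega) le_rfl h1.symm
    have ha0 : cornerOrbit ((shiftData E w).bcBondConfig ω) (cornerOrbit (E.bcBondConfig ω) a n) (L - n) = cornerOrbit (E.bcBondConfig ω) a 0 := by
      have h1 := hC n le_rfl hnL.le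
      rwa [Nat.sub_self] at h1
    have hsucc : nextCorner ((shiftData E w).bcBondConfig ω) (cornerOrbit ((shiftData E w).bcBondConfig ω) (cornerOrbit (E.bcBondConfig ω) a n) (L - n - 1)) = cornerOrbit (E.bcBondConfig ω) a 0 := by
      rw [← ha0]
      show cornerOrbit ((shiftData E w).bcBondConfig ω) (cornerOrbit (E.bcBondConfig ω) a n) (L - n - 1 + 1) = cornerOrbit ((shiftData E w).bcBondConfig ω) (cornerOrbit (E.bcBondConfig ω) a n) (L - n)
      rw [show L - n - 1 + 1 = L - n by omega]
    have hnear : dist (meshPoint E.δ (cornerOrbit ((shiftData E w).bcBondConfig ω) (cornerOrbit (E.bcBondConfig ω) a n) (L - n - 1)).1) (meshPoint E.δ (cornerOrbit (E.bcBondConfig ω) a 0).1) ≤ E.δ := by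
      apply dist_meshPoint_le_of_mem_cSrc_DM hδ.le
      rw [← hsucc, cSrc_nextCorner]
      exact Sym2.mem_mk_left _ _
    have hℓ1 : 1 ≤ L - n - 1 := by
      by_contra h
      have h0 : L - n - 1 = 0 := by omega
      rw [h0] at hnear
      have h3 : dist (meshPoint E.δ (cornerOrbit (E.bcBondConfig ω) a n).1) (meshPoint E.δ a.1) ≤ E.δ := hnear
      have h2 := hfar a.1 a.1 hcola (by rw [dist_comm]; exact h3)
      rw [dist_self] at h2
      linarith
    have hdisj : ∀ t, 1 ≤ t → t ≤ L - n - 1 → ∀ u ≤ n, cornerOrbit ((shiftData E w).bcBondConfig ω) (cornerOrbit (E.bcBondConfig ω) a n) t ≠ cornerOrbit (E.bcBondConfig ω) a u := by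
      intro t ht1 ht u hun h
      have hC' := hC (n - u) (by omega) (by omega)
      rw [show n - (n - u) = u by omega] at hC'
      rcases Nat.eq_zero_or_pos (n - u) with h0 | hpos
      · rw [h0, Nat.sub_zero, hΛL] at hC'
        exact hΛsimple 0 t (by omega) (by omega) (hC'.trans h.symm)
      · exact hΛsimple t (L - (n - u)) (by omega) (by omega) (h.trans hC'.symm)
    exact key 0 (L - n - 1) (by omega) hℓ1 (by omega) hcola hnear hdisj

end

end Summit.CriticalPhenomena.CardyFormulaZ2.Cruxes.EdgePrecompact.QkzStripBoundaryArm
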